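import Summits.AnomalousDissipation.AnomalousDissipation.Theorems.GalerkinSteadyZerothLaw.Negative.StokesStates
import Literature.Analysis.FluidPDE.NSGalerkinStationary

/-!
# Sub-goal `thick_transfer` of the line `idea-sketch-ideator2` (crux stmt-AnomalousDissipation-2986, `MirrorVariety.GalerkinSteadyZerothLaw`):
# the ν-axis reverse-Fatou transfer (port of crux-ideate r1 k1 gen 2, `Cruxes/GalerkinSteadyZerothLaw/SketchIdeator1G2.lean` §4)

THICK LOUD VISCOSITIES ⇒ THE CRUX.  Fix ONE admissible force `f` on `T³` (smooth, solenoidal, mean-free) and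
budgets `(E, ε)`, `0 < ε`, and call a viscosity `ν` LOUD at resolution `N` if `f` has an admissible Galerkin
steady state `U` there (`SteadyState ν N f U`, landed `Negative/LoadBearing.lean`) with `∫|U|² ≤ E` and
`ε ≤ ν‖∇U‖²`.  Hypothesis (inlined): at every viscosity scale `δ > 0` there is `p > 0` such that, FREQUENTLY in
`N`, the loud viscosities in `(0, δ)` contain a measurable set of Lebesgue measure `≥ p` — the loud windows may
DRIFT with `N`, only their size per scale is pinned.  Conclusion: `GalerkinSteadyZerothLaw` by name, with this
force, these budgets and a selected sequence `ν_j → 0⁺`; the crux's `∀ j, ∃ᶠ N` is met exactly (the landed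
`Negative.crux_iff` is `Iff.rfl`).

* `thick_transfer_reverse_fatou_nat` — reverse Fatou along `ℕ` inside a set of finite measure:
  `(∃ᶠ N, p ≤ μ (A N)) → p ≤ μ (⋂ n, ⋃ N ≥ n, A N)` (`Antitone.measure_iInter`).  This is the lemma
  `reverse_fatou_nat` of crux-ideate r1 IDEATOR 3 (`SketchIdeator3.lean`), reproduced verbatim in
  `SketchIdeator1G2.lean` §4 and ported here unchanged.
* `thick_transfer_viscositySelection` — the selection on the viscosity axis of crux-ideate r1 IDEATOR 1 gen 2
  (`viscositySelection`), stated directly for the measurable inner approximants of the registered hypothesis: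
  at the scale `δ = 1/(j+1)` choose at every `N` a measurable `A N ⊆ loud N ∩ (0, δ)` with `p ≤ |A N|` whenever
  one exists; reverse Fatou makes `limsup_N A N ⊆ (0, δ)` of measure `≥ p > 0`, hence non-empty, and any of its
  points `ν_j` is loud at infinitely many `N`; `0 < ν_j < 1/(j+1)` squeezes `ν_j → 0⁺`.
* `thick_transfer` — the registered sub-goal: ideator 1 gen 2's `galerkinSteadyZerothLaw_of_thickViscosities`
  with its hypothesis `LoudViscositiesThick f E ε` inlined (`loudViscosities`, `IsLoudBounded` unfolded, the
  sketch's `IsSteadyState` being definitionally the landed `SteadyState`), concluded through `crux_iff`.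
-/

noncomputable section

-- `Summit.<Summit>.<Problem>` is the tree's mandated summit-side namespace (CONVENTIONS §2); deliberate duplicate.
set_option linter.dupNamespace false

open scoped InnerProductSpace Topology ENNReal
open MeasureTheory Filter Set UnitAddTorus
open Literature.Analysis.FunctionSpaces Literature.Analysis.FunctionSpaces.Torus
open Literature.Analysis.FluidPDE Literature.Analysis.FluidPDE.Torus

namespace Summit.AnomalousDissipation.AnomalousDissipation.Theorems.GalerkinSteadyZerothLaw

open Summit.AnomalousDissipation.AnomalousDissipation.Theses.MirrorVariety (GalerkinSteadyZerothLaw)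
open Summit.AnomalousDissipation.AnomalousDissipation.Theorems.GalerkinSteadyZerothLaw.Negative
  (SteadyState BandLimited FrequentlyLoud LoudWitness crux_iff fieldOf steadyState_fieldOf integral_norm_sq_fieldOf loudness_fieldOf)
open Summit.AnomalousDissipation.AnomalousDissipation.Theorems.LaminarNeverLoud.Negative
  (modes forceCoeff energy dissipation modes_symm zero_not_mem_modes energy_nonneg dissipation_nonpos_of_nonpos
    isRealCoeff_forceCoeff)

/-- **Reverse Fatou along `ℕ`** inside a set of finite measure: if `p ≤ μ (A N)` for infinitely many `N`, then
`p ≤ μ (limsup A)` (written as `⋂ n, ⋃ N ≥ n, A N`): the tails `⋃ N ≥ n, A N` decrease, have finite measure,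
and each has measure `≥ p`.  Verbatim `reverse_fatou_nat` of crux-ideate r1 ideator 3 (as reproduced in
`SketchIdeator1G2.lean` §4). [folklore] -/
theorem thick_transfer_reverse_fatou_nat {α : Type*} [MeasurableSpace α] {μ : Measure α} {A : ℕ → Set α}
    {S : Set α} (hS : μ S ≠ ∞) (hA : ∀ N, MeasurableSet (A N)) (hAS : ∀ N, A N ⊆ S) {p : ℝ≥0∞}
    (hp : ∃ᶠ N in atTop, p ≤ μ (A N)) :
    p ≤ μ (⋂ n, ⋃ N, ⋃ (_ : n ≤ N), A N) := by
  have hDmeas : ∀ n, MeasurableSet (⋃ N, ⋃ (_ : n ≤ N), A N) := fun n =>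
    MeasurableSet.iUnion fun N => MeasurableSet.iUnion fun _ => hA N
  have hDS : ∀ n, (⋃ N, ⋃ (_ : n ≤ N), A N) ⊆ S := fun n =>
    Set.iUnion_subset fun N => Set.iUnion_subset fun _ => hAS N
  have hanti : ∀ n n', n ≤ n' → (⋃ N, ⋃ (_ : n' ≤ N), A N) ⊆ ⋃ N, ⋃ (_ : n ≤ N), A N := by
    intro n n' hnn' a ha
    simp only [Set.mem_iUnion] at ha ⊢
    obtain ⟨N, hN, haN⟩ := ha
    exact ⟨N, hnn'.trans hN, haN⟩
  have hanti' : Antitone fun n => ⋃ N, ⋃ (_ : n ≤ N), A N := fun n n' hnn' => hanti n n' hnn'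
  have hfin : ∃ n, μ (⋃ N, ⋃ (_ : n ≤ N), A N) ≠ ∞ :=
    ⟨0, ((measure_mono (hDS 0)).trans_lt hS.lt_top).ne⟩
  have key : μ (⋂ n, ⋃ N, ⋃ (_ : n ≤ N), A N) = ⨅ n, μ (⋃ N, ⋃ (_ : n ≤ N), A N) :=
    hanti'.measure_iInter (fun n => (hDmeas n).nullMeasurableSet) hfin
  rw [key]
  refine le_iInf fun n => ?_
  obtain ⟨N, hN, hpN⟩ := Filter.frequently_atTop.mp hp n
  exact hpN.trans (measure_mono fun a ha => Set.mem_iUnion.mpr ⟨N, Set.mem_iUnion.mpr ⟨hN, ha⟩⟩)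

/-- **Viscosity selection** (crux-ideate r1 ideator 1 gen 2, `viscositySelection`, inner-approximant form;
Lebesgue measure on `ℝ`).  If, at every scale `δ > 0`, the sets `L N` of "good viscosities" contain, for
infinitely many resolutions `N`, a measurable subset of `(0, δ)` of measure `≥ p δ > 0` — the good windows may
drift with `N` — then ONE sequence `ν_j → 0⁺` exists each of whose members is good at infinitely many
resolutions (reverse Fatou at the scales `δ = 1/(j+1)`, then a squeeze). [folklore] -/
theorem thick_transfer_viscositySelection (L : ℕ → Set ℝ)
    (hthick : ∀ δ : ℝ, 0 < δ → ∃ p : ℝ≥0∞, 0 < p ∧ ∃ᶠ N in atTop,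
      ∃ A : Set ℝ, MeasurableSet A ∧ A ⊆ L N ∩ Ioo 0 δ ∧ p ≤ volume A) :
    ∃ ν : ℕ → ℝ, (∀ j, 0 < ν j) ∧ Tendsto ν atTop (𝓝 0) ∧ ∀ j, ∃ᶠ N in atTop, ν j ∈ L N := by
  classical
  -- at each scale `δ`, one viscosity in `(0, δ)` that is good at infinitely many `N`
  have step : ∀ δ : ℝ, 0 < δ → ∃ ν ∈ Ioo (0 : ℝ) δ, ∃ᶠ N in atTop, ν ∈ L N := by
    intro δ hδ
    obtain ⟨p, hp, hfreq⟩ := hthick δ hδ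
    -- a measurable inner approximant of `L N ∩ (0, δ)` at every resolution (thick whenever one such exists)
    have key : ∀ N : ℕ, ∃ A : Set ℝ, MeasurableSet A ∧ A ⊆ L N ∩ Ioo 0 δ ∧
        ((∃ A' : Set ℝ, MeasurableSet A' ∧ A' ⊆ L N ∩ Ioo 0 δ ∧ p ≤ volume A') → p ≤ volume A) := by
      intro N
      by_cases hex : ∃ A' : Set ℝ, MeasurableSet A' ∧ A' ⊆ L N ∩ Ioo 0 δ ∧ p ≤ volume A'
      · obtain ⟨A', hA'm, hA'sub, hA'vol⟩ := hex
        exact ⟨A', hA'm, hA'sub, fun _ => hA'vol⟩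
      · exact ⟨∅, MeasurableSet.empty, empty_subset _, fun h' => absurd h' hex⟩
    choose A hAmeas hAsub hAvol using key
    have hS : volume (Ioo (0 : ℝ) δ) ≠ ∞ := by simp [Real.volume_Ioo]
    have hAS : ∀ N, A N ⊆ Ioo 0 δ := fun N => (hAsub N).trans inter_subset_right
    have hpA : ∃ᶠ N in atTop, p ≤ volume (A N) := hfreq.mono fun N hN => hAvol N hN
    have hlim := thick_transfer_reverse_fatou_nat hS hAmeas hAS hpA
    obtain ⟨ν, hν⟩ := nonempty_of_measure_ne_zero (hp.trans_le hlim).ne'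
    have hν0 := Set.mem_iInter.mp hν 0
    simp only [Set.mem_iUnion] at hν0
    obtain ⟨N₀, -, hN₀⟩ := hν0
    refine ⟨ν, hAS N₀ hN₀, Filter.frequently_atTop.mpr fun n => ?_⟩
    have hνn := Set.mem_iInter.mp hν n
    simp only [Set.mem_iUnion] at hνn
    obtain ⟨N, hN, hνN⟩ := hνn
    exact ⟨N, hN, (hAsub N hνN).1⟩
  choose ν hν hνgood using fun j : ℕ => step (1 / ((j : ℝ) + 1)) (by positivity)
  refine ⟨ν, fun j => (hν j).1, ?_, hνgood⟩
  -- squeeze: `0 < ν j < 1/(j+1) → 0`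
  have hupper : Tendsto (fun j : ℕ => 1 / ((j : ℝ) + 1)) atTop (𝓝 0) :=
    tendsto_one_div_add_atTop_nhds_zero_nat
  exact tendsto_of_tendsto_of_tendsto_of_le_of_le tendsto_const_nhds hupper
    (fun j => (hν j).1.le) (fun j => (hν j).2.le)

/-- **thick_transfer** (the ν-axis reverse-Fatou transfer, kernel-checked; crux-ideate r1 ideator 1 gen 2,
`galerkinSteadyZerothLaw_of_thickViscosities`, hypothesis inlined).  For ONE admissible force `f` and budgets
`(E, ε)`, `0 < ε`: if at every viscosity scale `δ > 0` some `p > 0` bounds from below, frequently in the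
resolution `N`, the Lebesgue measure of a measurable set of viscosities `ν ∈ (0, δ)` carrying a loud bounded
admissible Galerkin steady state (`SteadyState ν N f U`, `∫|U|² ≤ E`, `ε ≤ ν‖∇U‖²`), then the crux
`GalerkinSteadyZerothLaw` holds — with that force, those budgets and the sequence `ν_j → 0⁺` selected by
`thick_transfer_viscositySelection`; the crux's `∀ j, ∃ᶠ N` is matched exactly (`crux_iff`).  No line needs loud
states at prescribed viscosities, only on thick (possibly drifting) sets. [folklore] -/
theorem thick_transfer : ∀ (f : UnitAddTorus (Fin 3) → EuclideanSpace ℝ (Fin 3)) (E ε : ℝ),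
    IsSmooth f → IsDivFree f → HasZeroMean f → 0 < ε →
    (∀ δ : ℝ, 0 < δ → ∃ p : ENNReal, 0 < p ∧ ∃ᶠ N in Filter.atTop, ∃ A : Set ℝ, MeasurableSet A ∧
      A ⊆ {ν : ℝ | ∃ U : UnitAddTorus (Fin 3) → EuclideanSpace ℝ (Fin 3),
        SteadyState ν N f U ∧ ∫ x, ‖U x‖ ^ 2 ≤ E ∧ ε ≤ ν * gradNormSq U} ∩ Set.Ioo 0 δ ∧
      p ≤ MeasureTheory.volume A) → GalerkinSteadyZerothLaw := by
  intro f E ε hf hdf hzf hε h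
  obtain ⟨ν, hνpos, hν0, hνL⟩ := thick_transfer_viscositySelection
    (fun N => {ν : ℝ | ∃ U : UnitAddTorus (Fin 3) → EuclideanSpace ℝ (Fin 3),
      SteadyState ν N f U ∧ ∫ x, ‖U x‖ ^ 2 ≤ E ∧ ε ≤ ν * gradNormSq U}) h
  refine crux_iff.2 ⟨f, hf, hdf, hzf, ν, E, ε, hνpos, hν0, hε, fun j => ?_⟩
  exact (hνL j).mono fun N hN => hN

end Summit.AnomalousDissipation.AnomalousDissipation.Theorems.GalerkinSteadyZerothLaw

end

-- buildfix 2026-08-20 (ops-buildfix-1 gen 7): enqueue-only re-land — rebuild after B-35 (StokesArc, p233893) healed this module's import closure; no declaration changed.
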